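import Literature.NumberTheory.Transcendental.CyclotomicSimplexRep
import Mathlib.LinearAlgebra.Finsupp.LinearCombination
import Mathlib.LinearAlgebra.Span.Defs
import HarnessLib
import Summits.KontsevichZagierPeriods.KontsevichZagierPeriods.Theorems.OctahedralSymmetryOctahedralSpanAllWeightsDefs

/-!
# Crux `OctahedralSpanAllWeights` (stmt-KontsevichZagierPeriods-9659), line `Sketch`: `4`-free words reduce to `0`-free words

Helper file (lead c3) for the E block of the unit-pole filtration argument (route `OctahedralSymmetry`,
problem `KontsevichZagierPeriods`).

## What is proved

`elim_afree`: a convergent word `W : List (Fin 5)` WITHOUT the letter `4` (pole `0`) lies, modulo the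
relation module `rel`, in the span of the convergent words of the same length WITHOUT the letter `0`
(pole `1`) — in one step, whatever the number of letters `0` of `W`.  This sharpens the landed block E1
(`stub_elim_gt`: `#4 < #0 ⇒` fewer letters `0`) in the case `#4 = 0`, and is the fact that makes
`4`-free words "free" in every induction of the E block (lead c3's lab: the lexicographic peeling of the
E block uses exactly this).

## How

As for E1, one involution generator suffices: `[W] = invGen W + toQ (sigmaSubst W)` with `invGen W ∈ rel`
(`IsGen.inv`), and every word of `sigmaSubst W` arises from `W` letter by letter through Zhao's table
`0 ↦ [4] − [2]`, `1 ↦ [3] − [2]`, `2 ↦ −[2]`, `3 ↦ [1] − [2]`, `4 ↦ [0] − [2]`, in which the letter `0`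
occurs only in the image of `4`: a `4`-free source has `0`-free images (`count_zero_le_count_four`), and
the reversed images are convergent of the same length.

## Sources

J. Zhao, *Multiple polylogarithm values at roots of unity*, C. R. Acad. Sci. Paris 346 (2008), §4 (the
octahedral involution) [Zhao2008]; J. Zhao, *Standard relations of multiple polylogarithm values at roots
of unity*, Doc. Math. 15 (2010), §2 [Zhao2010].  The bookkeeping is folklore; the private lemmas repeat
those of `…StubElimGt.lean` (private there).
-/

noncomputable section

namespace Summit.KontsevichZagierPeriods.OctahedralSymmetry.OctaSpan

open Literature.NumberTheory.Transcendental Literature.NumberTheory.Transcendental.LevelFour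

namespace ElimAfree

/-- `toQ` of a term list all of whose words lie in `S` lies in the `ℚ`-span of `[V]`, `V ∈ S`. [folklore] -/
theorem toQ_ofTerms_mem_span {S : Set (List (Fin 5))} :
    ∀ L : List (ℤ × List (Fin 5)), (∀ p ∈ L, p.2 ∈ S) →
      toQ (ofTerms L) ∈ Submodule.span ℚ (sym '' S)
  | [], _ => by simp
  | p :: L, hL => by
    rw [ofTerms_cons, map_add, toQ_single]
    have hp : sym p.2 ∈ Submodule.span ℚ (sym '' S) :=
      Submodule.subset_span (Set.mem_image_of_mem sym (hL p (by simp)))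
    exact Submodule.add_mem _ (zsmul_mem hp _)
      (toQ_ofTerms_mem_span L fun q hq => hL q (by simp [hq]))

/-- The words of `expand φ W` arise from `W` letter by letter: the `j`-th letter of an expanded word is
one of the letters of `φ (W j)`. [folklore] -/
theorem forall₂_of_mem_expand (φ : Fin 5 → List (ℤ × Fin 5)) :
    ∀ (W : List (Fin 5)) {cV : ℤ × List (Fin 5)}, cV ∈ expand φ W →
      List.Forall₂ (fun b a => b ∈ (φ a).map Prod.snd) cV.2 W
  | [], cV, h => by
    rw [expand_nil, List.mem_singleton] at h
    subst h
    exact List.Forall₂.nil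
  | m :: W, cV, h => by
    simp only [expand_cons, List.mem_flatMap, List.mem_map] at h
    obtain ⟨cb, hcb, dV, hdV, rfl⟩ := h
    exact List.Forall₂.cons (List.mem_map.2 ⟨cb, hcb, rfl⟩) (forall₂_of_mem_expand φ W hdV)

/-- In Zhao's table the letter `0` occurs only in `sigmaLetter 4`. [cite: Zhao2008, §4] -/
theorem eq_four_of_mem_sigmaLetter_zero :
    ∀ a b : Fin 5, b ∈ (sigmaLetter a).map Prod.snd → b = 0 → a = 4 := by
  decide

/-- In Zhao's table the letter `4` occurs only in `sigmaLetter 0`. [cite: Zhao2008, §4] -/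
theorem eq_zero_of_mem_sigmaLetter_four :
    ∀ a b : Fin 5, b ∈ (sigmaLetter a).map Prod.snd → b = 4 → a = 0 := by
  decide

/-- Along the `σ`-expansion the number of letters `0` of an expanded word is at most the number of
letters `4` of the source word. [folklore] -/
theorem count_zero_le_count_four {V W : List (Fin 5)}
    (h : List.Forall₂ (fun b a => b ∈ (sigmaLetter a).map Prod.snd) V W) :
    V.count 0 ≤ W.count 4 := by
  induction h with
  | nil => simp
  | @cons b a V W hba _ ih =>
    rcases eq_or_ne b 0 with rfl | hb
    · obtain rfl : a = 4 := eq_four_of_mem_sigmaLetter_zero a 0 hba rfl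
      rw [List.count_cons_self, List.count_cons_self]
      exact Nat.succ_le_succ ih
    · rw [List.count_cons_of_ne hb]
      exact ih.trans List.count_le_count_cons

/-- If the letter `x` of an expanded word can only come from the letter `y` of the source and the
source does not start with `y`, the expanded word does not start with `x`. [folklore] -/
theorem head?_ne_of_forall₂ {R : Fin 5 → Fin 5 → Prop} {x y : Fin 5}
    (hR : ∀ a b, R b a → b = x → a = y) {V W : List (Fin 5)} (h : List.Forall₂ R V W)
    (hW : W.head? ≠ some y) : V.head? ≠ some x := by
  cases h with
  | nil => simp
  | @cons b a V W hba _ =>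
    simp only [List.head?_cons, ne_eq, Option.some.injEq] at hW ⊢
    exact fun hb => hW (hR a b hba hb)

/-- For a convergent `4`-free `W`, every reversed word of `expand sigmaLetter W` is a convergent
`0`-free word of the same length. [cite: Zhao2008, §4] -/
theorem reverse_mem_zeroFree {W : List (Fin 5)} (hW : IsConvergent W) (h4 : W.count 4 = 0)
    {cV : ℤ × List (Fin 5)} (hcV : cV ∈ expand sigmaLetter W) :
    cV.2.reverse ∈ {V | V.length = W.length ∧ IsConvergent V ∧ V.count 0 = 0} := by
  have hF := forall₂_of_mem_expand sigmaLetter W hcV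
  refine ⟨by rw [List.length_reverse, hF.length_eq], ⟨?_, ?_⟩, ?_⟩
  · exact head?_ne_of_forall₂ eq_four_of_mem_sigmaLetter_zero (List.rel_reverse hF)
      (by rw [List.head?_reverse]; exact hW.2)
  · rw [List.getLast?_reverse]
    exact head?_ne_of_forall₂ eq_zero_of_mem_sigmaLetter_four hF hW.1
  · rw [List.count_reverse]
    exact Nat.eq_zero_of_le_zero ((count_zero_le_count_four hF).trans_eq h4)

end ElimAfree

open ElimAfree in
/-- **`4`-free words are `0`-free modulo `rel` (all weights, one involution generator).** A convergent
word `W` without the letter `4` (pole `0`) lies, modulo `rel`, in the `ℚ`-span of the convergent words of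
the same length without the letter `0` (pole `1`): `[W] = invGen W + sigmaSubst W` and the pole `1` of a
word of `sigmaSubst W` can only come from a pole `0` of `W`. [cite: Zhao2008, §4] -/
theorem elim_afree (W : List (Fin 5)) (hW : IsConvergent W) (h4 : W.count 4 = 0) :
    sym W ∈ rel ⊔ Submodule.span ℚ (sym '' {V | V.length = W.length ∧ IsConvergent V ∧ V.count 0 = 0}) := by
  rw [show sym W = invGen W + toQ (sigmaSubst W) from (sub_add_cancel _ _).symm]
  refine Submodule.add_mem _ (Submodule.mem_sup_left (mem_rel_of_isGen (IsGen.inv hW)))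
    (Submodule.mem_sup_right ?_)
  unfold sigmaSubst
  rw [map_zsmul]
  refine zsmul_mem (toQ_ofTerms_mem_span _ fun p hp => ?_) _
  obtain ⟨cV, hcV, rfl⟩ := List.mem_map.1 hp
  exact reverse_mem_zeroFree hW h4 hcV

open ElimAfree in
/-- **Corollary (the form used by the E-block inductions).** A convergent `4`-free word with a letter `0`
reduces, modulo `rel`, to convergent words of the same length with fewer letters `0` or with as many
letters `0` and fewer letters `4` (indeed to `0`-free words). [cite: Zhao2008, §4] -/
theorem elim_afree_lex (W : List (Fin 5)) (hW : IsConvergent W) (h4 : W.count 4 = 0)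
    (h0 : 0 < W.count 0) :
    sym W ∈ rel ⊔ Submodule.span ℚ (sym '' {V | V.length = W.length ∧ IsConvergent V ∧
      (V.count 0 < W.count 0 ∨ (V.count 0 = W.count 0 ∧ V.count 4 < W.count 4))}) := by
  have hle : Submodule.span ℚ (sym '' {V | V.length = W.length ∧ IsConvergent V ∧ V.count 0 = 0}) ≤
      Submodule.span ℚ (sym '' {V | V.length = W.length ∧ IsConvergent V ∧
        (V.count 0 < W.count 0 ∨ (V.count 0 = W.count 0 ∧ V.count 4 < W.count 4))}) :=
    Submodule.span_mono (Set.image_mono fun V (hV : V.length = W.length ∧ IsConvergent V ∧ V.count 0 = 0) =>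
      ⟨hV.1, hV.2.1, Or.inl (hV.2.2 ▸ h0)⟩)
  exact sup_le_sup_left hle _ (elim_afree W hW h4)

end Summit.KontsevichZagierPeriods.OctahedralSymmetry.OctaSpan

end
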